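import Literature.AlgebraicGeometry.AbelianSchemes.TorsionSectionPairing
import HarnessLib

/-!
# Base change of the relative character pairing `e_n(g, L)`: along a square `A′ → A` over `S′ → S` the pairing units pull back
# ([MumfordAV1970] §20; cell hodgecm-mathlib (h9-S) (S2) (W1c))

Layer `Literature/AlgebraicGeometry/AbelianSchemes`, namespace `Literature.AlgebraicGeometry.AbelianSchemes.AbelianSchemeOver.TorsionPairing`.
THEOREMS ONLY (no definition, no named fact, no instance, no `sorry`).  Sequel of ★-to-be `TorsionSectionPairing` (W1b).

Setting: abelian schemes `A/S`, `A′/S′` over locally Noetherian bases, a morphism of total spaces `ι : A′ → A` over a base map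
`t : S′ → S` (`ι ≫ π = π′ ≫ t`) commuting with the multiplications (`ι ≫ [n]_A = [n]_{A′} ≫ ι`; e.g. `A′ = A ×_S S′`, ★
`baseChangeHom_mulN`), actions `ρ`, `ρ′` of one group `K` on `A`, `A′` over `[n]_A`, `[n]_{A′}` intertwined by `ι`
(`ρ′_g ≫ ι = ι ≫ ρ_g`; e.g. translations by sections and by their pull-backs) — ALL VARIABLE —, a line bundle `L` on `A` with
`e : [n]^* L ≅ [n]^* 𝒪_A` and pairing units `c_g ∈ Γ(S, 𝒪_S)` (the discrepancy equations of W1b), and on `A′` any line bundle `L′`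
with `j₁ : L′ ≅ ι^* L` and `j₀ : ι^* 𝒪_A ≅ 𝒪_{A′}`.  Then:

* §1 `appTop_comm` — `ι^♯ [n]^♯ π^♯ c = [n]′^♯ π′^♯ t^♯ c`;
* §2 **`discrepancy_baseChange`** — the transported isomorphism
  `e′ := [n]′^* j₁ ≫ sq⁻¹ ≫ ι^* e ≫ sq ≫ [n]′^* j₀ : [n]′^* L′ ≅ [n]′^* 𝒪_{A′}` has the discrepancy equations with scalars
  `[n]′^♯ π′^♯ (t^♯ c_g)` (★ `discrepancy_restrict` for the square + ★ `discrepancy_conj` for `j₀, j₁`);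
* §3 **`pairingUnit_baseChange`** — hence, for EVERY trivialisation `e″ : [n]′^* L′ ≅ [n]′^* 𝒪_{A′}` and its pairing units `c′_g`
  (W1b `existsUnique_pairingUnit`), `c′_g = t^♯ c_g` (W1b `pairingUnit_eq_of_iso`): THE PAIRING UNITS PULL BACK.  With `t` a
  geometric point this is the fibre evaluation the transport (W3) reads; with `S′` connected and ★ `RootOfUnityRigidConnected`
  the units are rigid.

Cell hodgecm-mathlib (D-0151), F-DAG (h9) symplectic half (S2) road (W1) (census `B-provers/B-p13/g18/CENSUS-h9S-LevelTransport`).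
Count-neutral capital; HC_CM is proved only modulo the 7 printed citations until rung 0 closes — nothing here is about HC.

## References
* [MumfordAV1970] D. Mumford, *Abelian Varieties* (1970), §7 Prop. 2 (p. 70), §12 Thm. 1 (p. 112), §20 (pp. 183–185).
* Tree: ★ `RelativeSpec.PullbackIsoDiscrepancy` (`discrepancy_restrict`, `discrepancy_conj`), ★ `Modules.EquivariantStructureRestrict`
  (`squareIso`), ★-to-be `TorsionSectionPairing` (`existsUnique_pairingUnit`, `pairingUnit_eq_of_iso`).
-/

set_option autoImplicit false

noncomputable section

-- `TopCat.Presheaf`/`Scheme.Modules` are not reducible (as in Mathlib's `AlgebraicGeometry/Modules`).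
set_option backward.isDefEq.respectTransparency false

universe u

open CategoryTheory CategoryTheory.Limits AlgebraicGeometry MonoidalCategory CartesianMonoidalCategory TopologicalSpace
  Opposite
open scoped MonObj

namespace Literature.AlgebraicGeometry.AbelianSchemes.AbelianSchemeOver.TorsionPairing

open Literature.AlgebraicGeometry.RelativeSpec Literature.AlgebraicGeometry.Modules Literature.AlgebraicGeometry.Motives
  Literature.AlgebraicGeometry.HodgeTheory Literature.AlgebraicGeometry.Morphisms
  Literature.AlgebraicGeometry.RelativeSpec.ActionOver

variable {S S' : Scheme.{u}} {A : AbelianSchemeOver S} {A' : AbelianSchemeOver S'} {K : Type u} [Group K] {n : ℕ}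
  (t : S' ⟶ S) (q : A'.X.left ⟶ A.X.left) (ht : q ≫ A.X.hom = A'.X.hom ≫ t)
  (hsq : q ≫ (A.mulN n).left = (A'.mulN n).left ≫ q)
  (ρ : ActionOver (A.mulN n).left K) (ρ' : ActionOver (A'.mulN n).left K)
  (hι : ∀ g : K, ρ'.autHom g ≫ q = q ≫ ρ.autHom g)
  (L : A.X.left.Modules) (hL : HasRank L 1)
  (e : (Scheme.Modules.pullback (A.mulN n).left).obj L ≅
    (Scheme.Modules.pullback (A.mulN n).left).obj (SheafOfModules.unit A.X.left.ringCatSheaf))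
  (L' : A'.X.left.Modules) (j₁ : L' ≅ (Scheme.Modules.pullback q).obj L)
  (j₀ : (Scheme.Modules.pullback q).obj (SheafOfModules.unit A.X.left.ringCatSheaf) ≅
    SheafOfModules.unit A'.X.left.ringCatSheaf)
  (c : K → Γ(S, ⊤))
  (hc : ∀ g : K, (Scheme.Modules.pullback (ρ.autHom g)).map e.hom ≫
        ((EquivariantStructure.ofPullback ρ (SheafOfModules.unit A.X.left.ringCatSheaf)).iso g).hom =
      ((EquivariantStructure.ofPullback ρ L).iso g).hom ≫ e.hom ≫
        globalScalar _ ((A.mulN n).left.appTop (A.X.hom.appTop (c g))))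

/-! ## §1 Functions: `ι^♯ [n]^♯ π^♯ c = [n]′^♯ π′^♯ t^♯ c` -/

include ht hsq in
/-- `ι^♯ ([n]^♯ π^♯ x) = [n]′^♯ (π′^♯ (t^♯ x))` along the square. [cite: MumfordAV1970, §7 Prop. 2 (p. 70)] -/
theorem appTop_comm (x : Γ(S, ⊤)) :
    q.appTop ((A.mulN n).left.appTop (A.X.hom.appTop x)) = (A'.mulN n).left.appTop (A'.X.hom.appTop (t.appTop x)) := by
  have h : q ≫ (A.mulN n).left ≫ A.X.hom = (A'.mulN n).left ≫ A'.X.hom ≫ t := by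
    rw [← Category.assoc, hsq, Category.assoc, ht]
  change ((A.X.hom.appTop ≫ (A.mulN n).left.appTop) ≫ q.appTop) x =
    ((t.appTop ≫ A'.X.hom.appTop) ≫ (A'.mulN n).left.appTop) x
  rw [← Scheme.Hom.comp_appTop, ← Scheme.Hom.comp_appTop, ← Scheme.Hom.comp_appTop, ← Scheme.Hom.comp_appTop, h]

/-! ## §2 The transported trivialisation and its discrepancies -/

include ht hι hL hc in
/-- **BASE CHANGE OF THE DISCREPANCIES**: the transported isomorphism
`e′ := [n]′^* j₁ ≫ sq⁻¹ ≫ ι^* e ≫ sq ≫ [n]′^* j₀ : [n]′^* L′ ≅ [n]′^* 𝒪_{A′}` satisfies the discrepancy equations for `ρ′` with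
the scalars `[n]′^♯ π′^♯ (t^♯ c_g)` (★ `discrepancy_restrict` along the square `ι ≫ [n] = [n]′ ≫ ι`, then ★ `discrepancy_conj`
by `j₀, j₁`, then `appTop_comm`). [cite: MumfordAV1970, §20 (p. 184)] [cite: MumfordAV1970, §7 Prop. 2 (p. 70)] -/
theorem discrepancy_baseChange (g : K) :
    (Scheme.Modules.pullback (ρ'.autHom g)).map
          ((Scheme.Modules.pullback (A'.mulN n).left).mapIso j₁ ≪≫
            ((squareIso hsq L).symm ≪≫ (Scheme.Modules.pullback q).mapIso e ≪≫
              squareIso hsq (SheafOfModules.unit A.X.left.ringCatSheaf)) ≪≫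
            (Scheme.Modules.pullback (A'.mulN n).left).mapIso j₀).hom ≫
        ((EquivariantStructure.ofPullback ρ' (SheafOfModules.unit A'.X.left.ringCatSheaf)).iso g).hom =
      ((EquivariantStructure.ofPullback ρ' L').iso g).hom ≫
        ((Scheme.Modules.pullback (A'.mulN n).left).mapIso j₁ ≪≫
            ((squareIso hsq L).symm ≪≫ (Scheme.Modules.pullback q).mapIso e ≪≫
              squareIso hsq (SheafOfModules.unit A.X.left.ringCatSheaf)) ≪≫
            (Scheme.Modules.pullback (A'.mulN n).left).mapIso j₀).hom ≫
          globalScalar _ ((A'.mulN n).left.appTop (A'.X.hom.appTop (t.appTop (c g)))) := by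
  have hres := discrepancy_restrict ρ ρ' q q hsq hι (SheafOfModules.unit A.X.left.ringCatSheaf) L hasRank_unitModule hL e
    (fun g => (A.mulN n).left.appTop (A.X.hom.appTop (c g))) hc g
  have hconj := discrepancy_conj ρ' _ _
    ((squareIso hsq L).symm ≪≫ (Scheme.Modules.pullback q).mapIso e ≪≫
      squareIso hsq (SheafOfModules.unit A.X.left.ringCatSheaf)) j₀ j₁ _ g hres
  rw [appTop_comm t q ht hsq (c g)] at hconj
  exact hconj

/-! ## §3 The pairing units pull back -/

include ht hsq hι hL j₁ j₀ hc in
/-- **THE PAIRING UNITS PULL BACK**: for EVERY trivialisation `e″ : [n]′^* L′ ≅ [n]′^* 𝒪_{A′}` with pairing units `c′_g`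
(W1b `existsUnique_pairingUnit` for `A′`), `c′_g = t^♯ c_g` — independence of the trivialisation (W1b `pairingUnit_eq_of_iso`)
applied to `e″` and the transported `e′` of §2.  With `t` a geometric point: the fibre evaluation of `e_n`; with `S′` connected:
rigidity via ★ `RootOfUnityRigidConnected`. [cite: MumfordAV1970, §20 (p. 184)] -/
theorem pairingUnit_baseChange [IsLocallyNoetherian S']
    (e'' : (Scheme.Modules.pullback (A'.mulN n).left).obj L' ≅
      (Scheme.Modules.pullback (A'.mulN n).left).obj (SheafOfModules.unit A'.X.left.ringCatSheaf))
    (g : K) (c' : Γ(S', ⊤))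
    (hc' : (Scheme.Modules.pullback (ρ'.autHom g)).map e''.hom ≫
        ((EquivariantStructure.ofPullback ρ' (SheafOfModules.unit A'.X.left.ringCatSheaf)).iso g).hom =
      ((EquivariantStructure.ofPullback ρ' L').iso g).hom ≫ e''.hom ≫
        globalScalar _ ((A'.mulN n).left.appTop (A'.X.hom.appTop c'))) :
    c' = t.appTop (c g) :=
  pairingUnit_eq_of_iso A' ρ' L' e'' _ g c' (t.appTop (c g)) hc'
    (discrepancy_baseChange t q ht hsq ρ ρ' hι L hL e L' j₁ j₀ c hc g)

end Literature.AlgebraicGeometry.AbelianSchemes.AbelianSchemeOver.TorsionPairing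

end
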